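import Summits.CriticalPhenomena.PercolationContinuityZ3.Theorems.PercNearOneGluingNoHeavyLowerTailGZParallel
import HarnessLib

/-!
# `NoHeavyLowerTail` (stmt-CriticalPhenomena-4575) — support file: **THEOREM W** (cell level), the logarithmic
# covariance bound on the WHEATSTONE BRIDGE with hubs at its two internal vertices

Support file (`--supports stmt-CriticalPhenomena-4575`; closes nothing; no definitions, no named facts, no sorries),
prover `prim-ineq-prove-2` gen 14, memo `run/shared/lean/prim/prim-ineq-prove-2/THEOREM-W.md`.
The bound `Cov(1{a↔c},1{b↔c}) ≤ P(ab|c)·log(P(a↔b off c)/P(ab|c))` (Gladkov–Zimin Conj. 6.3 / Gladkov Conj. 10.1 with modulus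
`w log(1/w)`) is a theorem of this tree on every two-terminal series–parallel hub network (`GZSP.sp_cov_le`).  The first
`a–b` core that is NOT series–parallel is the Wheatstone bridge `W = K₄ − ab` (edges `au, av, ub, vb, uv`) with the hub `c`
joined to the internal vertices `u, v`.  With `α₁, α₂, β₁, β₂, ρ, γ₁, γ₂` the weights of `au, av, ub, vb, uv, cu, cv`, the numbers
`θ = P(a↔b off c)`, `w = P(ab|c)`, `P(a↔c)`, `P(b↔c)`, `P(a↔c ∧ b↔c)` of this 7-edge graph are the explicit polynomials in the
hypotheses `hθ, hw, hPA, hPB, hPAB` below (enumeration of the 2⁷ configurations, memo §1; e.g. `θ = p_a p_b − (1−ρ)X×`,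
`p_a = 1−(1−α₁)(1−α₂)`, `X× = (1−α₁)α₂·β₁(1−β₂) + α₁(1−α₂)·(1−β₁)β₂` the 'crossed' single-edge mass).
* `club` — LEMMA ♣ of the memo: `s₁²X₁ + s₂²X₂ + s₁s₂X× ≤ P·(s₀ log(θ/w) + w/θ − 2s₀ + s₀²)` for `θ = P − X×`,
  `w = s₀θ + s₁X₁ + s₂X₂`; proof = `log y ≤ y − 1` three times.
* `wheatstone_cov_le_of_C4` — **bridge-edge monotonicity**: the cells at bridge weight `ρ` satisfy the bound as soon as the
  cells at `ρ = 0` (the 4-cycle with hubs at `u, v`) do: `Φ(W_ρ) − (1−ρ)Φ(W₀) ≥ ρ·(p_a p_b Λ − (1−ρ)KYZ) ≥ 0` by the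
  supergradient inequality of `w log(θ/w)` (`GZParallel.mul_log_div_le`), the affine structure of the cells in `ρ`, and `club`.
* `c4_cov_le` — the case `ρ = 0` from the parallel step `GZParallel.parallel_cov_sub_mul_log_le` for the two hub paths.
* `wheatstone_cov_le` — **THEOREM W (cell level)**.
The identification of the polynomials with the `prodBernoulli` probabilities of the 7-edge graph (checked with exact rational
arithmetic in the memo's scripts) is not done here; it is the remaining plumbing for a measure-level statement.
[this work — memo THEOREM-W.md; conjecture: GladkovZimin2024 Conj. 6.3, Gladkov2024 Conj. 10.1]
-/

namespace Summit.CriticalPhenomena.PercolationContinuityZ3.Theorems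

namespace GZWheatstone

/-- **LEMMA ♣** (memo THEOREM-W.md §3), homogeneous form.  For `γ₁, γ₂ ∈ [0,1)`, `X₁, X₂, X× ≥ 0` with
`X× < P` (the constraint `X₁ + X₂ + X× ≤ P` of the memo is not even needed), put `s₀ = (1−γ₁)(1−γ₂)`, `s₁ = γ₁(1−γ₂)`, `s₂ = (1−γ₁)γ₂`, `θ = P − X×`,
`w = s₀θ + s₁X₁ + s₂X₂`.  Then `s₁²X₁ + s₂²X₂ + s₁s₂X× ≤ P·(s₀·log(θ/w) + w/θ − 2s₀ + s₀²)`.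
Proof: with `Λ` the bracket, `θΛ ≥ (1−s₀)(s₁X₁+s₂X₂)` and `Λ ≥ s₁s₂`, each from `log y ≤ y − 1`. [this work] -/
theorem club {γ₁ γ₂ X₁ X₂ Xc P s₀ s₁ s₂ θ w : ℝ}
    (hγ₁ : 0 ≤ γ₁) (hγ₁1 : γ₁ < 1) (hγ₂ : 0 ≤ γ₂) (hγ₂1 : γ₂ < 1)
    (hX₁ : 0 ≤ X₁) (hX₂ : 0 ≤ X₂) (hXc : 0 ≤ Xc) (hXP : Xc < P)
    (hs₀ : s₀ = (1 - γ₁) * (1 - γ₂)) (hs₁ : s₁ = γ₁ * (1 - γ₂)) (hs₂ : s₂ = (1 - γ₁) * γ₂)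
    (hθ : θ = P - Xc) (hw : w = s₀ * θ + (s₁ * X₁ + s₂ * X₂)) :
    s₁ ^ 2 * X₁ + s₂ ^ 2 * X₂ + s₁ * s₂ * Xc ≤ P * (s₀ * Real.log (θ / w) + w / θ - 2 * s₀ + s₀ ^ 2) := by
  have hθpos : 0 < θ := by rw [hθ]; linarith
  have h1γ₁ : 0 < 1 - γ₁ := by linarith
  have h1γ₂ : 0 < 1 - γ₂ := by linarith
  have hs₀pos : 0 < s₀ := by rw [hs₀]; exact mul_pos h1γ₁ h1γ₂
  have hs₁nn : 0 ≤ s₁ := by rw [hs₁]; exact mul_nonneg hγ₁ h1γ₂.le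
  have hs₂nn : 0 ≤ s₂ := by rw [hs₂]; exact mul_nonneg h1γ₁.le hγ₂
  have hmnn : 0 ≤ s₁ * X₁ + s₂ * X₂ := add_nonneg (mul_nonneg hs₁nn hX₁) (mul_nonneg hs₂nn hX₂)
  have hwpos : 0 < w := by
    rw [hw]; exact add_pos_of_pos_of_nonneg (mul_pos hs₀pos hθpos) hmnn
  set L := Real.log (θ / w) with hL
  set q := w / θ with hq
  have hqpos : 0 < q := by rw [hq]; exact div_pos hwpos hθpos
  have hwq : w = θ * q := by rw [hq]; field_simp
  have hm : s₁ * X₁ + s₂ * X₂ = θ * (q - s₀) := by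
    have : s₁ * X₁ + s₂ * X₂ = w - s₀ * θ := by rw [hw]; ring
    rw [this, hwq]; ring
  have hqs₀ : 0 ≤ q - s₀ := by
    have h : 0 ≤ θ * (q - s₀) := by rw [← hm]; exact hmnn
    nlinarith
  have hLq : L = -Real.log q := by
    have e : θ / w = (w / θ)⁻¹ := by rw [inv_div]
    rw [hL, e, Real.log_inv]
  have hlog1 : 1 - q ≤ L := by
    have h := Real.log_le_sub_one_of_pos hqpos
    rw [hLq]; linarith
  have hlog2 : Real.log q ≤ Real.log s₀ + (q - s₀) / s₀ := by
    have h := Real.log_le_sub_one_of_pos (div_pos hqpos hs₀pos)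
    rw [Real.log_div hqpos.ne' hs₀pos.ne'] at h
    have e : q / s₀ - 1 = (q - s₀) / s₀ := by field_simp
    linarith
  have hlogs₀ : γ₁ + γ₂ ≤ -Real.log s₀ := by
    rw [hs₀, Real.log_mul h1γ₁.ne' h1γ₂.ne']
    have h1 := Real.log_le_sub_one_of_pos h1γ₁
    have h2 := Real.log_le_sub_one_of_pos h1γ₂
    linarith
  -- (LB1)  θ·Λ − (1−s₀)·m = θ s₀ (L − 1 + q) ≥ 0
  have LB1 : (1 - s₀) * (s₁ * X₁ + s₂ * X₂) ≤ θ * (s₀ * L + q - 2 * s₀ + s₀ ^ 2) := by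
    rw [hm]
    have e : θ * (s₀ * L + q - 2 * s₀ + s₀ ^ 2) - (1 - s₀) * (θ * (q - s₀)) = θ * s₀ * (L - 1 + q) := by ring
    have h : 0 ≤ θ * s₀ * (L - 1 + q) := mul_nonneg (mul_nonneg hθpos.le hs₀pos.le) (by linarith)
    linarith
  -- (LB2)  Λ ≥ −s₀ log s₀ − s₀ + s₀² ≥ s₀(γ₁ + γ₂ − 1 + s₀) = s₁ s₂
  have LB2 : s₁ * s₂ ≤ s₀ * L + q - 2 * s₀ + s₀ ^ 2 := by
    have h1 : s₀ * (-Real.log s₀ - (q - s₀) / s₀) ≤ s₀ * L := by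
      refine mul_le_mul_of_nonneg_left ?_ hs₀pos.le
      rw [hLq]; linarith
    have e1 : s₀ * (-Real.log s₀ - (q - s₀) / s₀) = s₀ * (-Real.log s₀) - (q - s₀) := by field_simp
    have h2 : s₀ * (γ₁ + γ₂) ≤ s₀ * (-Real.log s₀) := mul_le_mul_of_nonneg_left hlogs₀ hs₀pos.le
    have e2 : s₁ * s₂ = s₀ * (γ₁ + γ₂) - s₀ + s₀ ^ 2 := by rw [hs₀, hs₁, hs₂]; ring
    linarith
  have hΛnn : 0 ≤ s₀ * L + q - 2 * s₀ + s₀ ^ 2 := le_trans (mul_nonneg hs₁nn hs₂nn) LB2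
  have hs₁le : s₁ ≤ 1 - s₀ := by
    have e : 1 - s₀ - s₁ = γ₂ := by rw [hs₀, hs₁]; ring
    linarith
  have hs₂le : s₂ ≤ 1 - s₀ := by
    have e : 1 - s₀ - s₂ = γ₁ := by rw [hs₀, hs₂]; ring
    linarith
  have hA₁ : s₁ * (s₁ * X₁) ≤ (1 - s₀) * (s₁ * X₁) := mul_le_mul_of_nonneg_right hs₁le (mul_nonneg hs₁nn hX₁)
  have hA₂ : s₂ * (s₂ * X₂) ≤ (1 - s₀) * (s₂ * X₂) := mul_le_mul_of_nonneg_right hs₂le (mul_nonneg hs₂nn hX₂)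
  have hB : Xc * (s₁ * s₂) ≤ Xc * (s₀ * L + q - 2 * s₀ + s₀ ^ 2) := mul_le_mul_of_nonneg_left LB2 hXc
  have hPe : P = θ + Xc := by rw [hθ]; ring
  have eL : s₁ ^ 2 * X₁ + s₂ ^ 2 * X₂ + s₁ * s₂ * Xc = s₁ * (s₁ * X₁) + s₂ * (s₂ * X₂) + Xc * (s₁ * s₂) := by ring
  have eR : P * (s₀ * L + q - 2 * s₀ + s₀ ^ 2) =
      θ * (s₀ * L + q - 2 * s₀ + s₀ ^ 2) + Xc * (s₀ * L + q - 2 * s₀ + s₀ ^ 2) := by rw [hPe]; ring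
  rw [eL, eR]
  linarith

/-- **Bridge-edge monotonicity step** (memo THEOREM-W.md §2–§4): for the Wheatstone bridge with hubs at `u, v`
(weights `α₁ = w(au)`, `α₂ = w(av)`, `β₁ = w(ub)`, `β₂ = w(vb)`, `ρ = w(uv)`, `γ₁ = w(cu)`, `γ₂ = w(cv)`), the cell
polynomials at bridge weight `ρ` satisfy the logarithmic covariance bound as soon as the cells at `ρ = 0` (the 4-cycle with
hubs at `u, v`) do.  The proof is `E − (1−ρ)E_C ≥ ρ[w_M(L−1) + wθ_M/θ]` (supergradient of `w log(θ/w)`, `GZParallel.mul_log_div_le`),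
`Cov − (1−ρ)Cov_C = ρ·Cov_M + ρ(1−ρ)ΔuΔv` (cells affine in `ρ`), and `club`. [this work] -/
theorem wheatstone_cov_le_of_C4 {α₁ α₂ β₁ β₂ ρ γ₁ γ₂ : ℝ}
    (hα₁ : 0 < α₁) (hα₁1 : α₁ < 1) (hα₂ : 0 < α₂) (hα₂1 : α₂ < 1)
    (hβ₁ : 0 < β₁) (hβ₁1 : β₁ < 1) (hβ₂ : 0 < β₂) (hβ₂1 : β₂ < 1)
    (hρ : 0 ≤ ρ) (hρ1 : ρ ≤ 1) (hγ₁ : 0 ≤ γ₁) (hγ₁1 : γ₁ < 1) (hγ₂ : 0 ≤ γ₂) (hγ₂1 : γ₂ < 1)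
    {s₀ s₁ s₂ s₃ pa pb y₁ y₂ z₁ z₂ X₁ X₂ Xc θ w PA PB PAB θC wC PAC PBC PABC : ℝ}
    (hs₀ : s₀ = (1 - γ₁) * (1 - γ₂)) (hs₁ : s₁ = γ₁ * (1 - γ₂)) (hs₂ : s₂ = (1 - γ₁) * γ₂) (hs₃ : s₃ = γ₁ * γ₂)
    (hpa : pa = 1 - (1 - α₁) * (1 - α₂)) (hpb : pb = 1 - (1 - β₁) * (1 - β₂))
    (hy₁ : y₁ = (1 - α₁) * α₂) (hy₂ : y₂ = α₁ * (1 - α₂)) (hz₁ : z₁ = (1 - β₁) * β₂) (hz₂ : z₂ = β₁ * (1 - β₂))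
    (hX₁ : X₁ = y₁ * z₁) (hX₂ : X₂ = y₂ * z₂) (hXc : Xc = y₁ * z₂ + y₂ * z₁)
    (hθ : θ = pa * pb - (1 - ρ) * Xc) (hw : w = s₀ * θ + (1 - ρ) * (s₁ * X₁ + s₂ * X₂))
    (hPA : PA = (1 - ρ) * (s₁ * (α₁ + y₁ * (β₁ * β₂)) + s₂ * (α₂ + y₂ * (β₁ * β₂)) + s₃ * pa) + ρ * ((1 - s₀) * pa))
    (hPB : PB = (1 - ρ) * (s₁ * (β₁ + z₁ * (α₁ * α₂)) + s₂ * (β₂ + z₂ * (α₁ * α₂)) + s₃ * pb) + ρ * ((1 - s₀) * pb))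
    (hPAB : PAB = θ - w + s₃ * ((1 - ρ) * Xc))
    (hθC : θC = pa * pb - Xc) (hwC : wC = s₀ * θC + (s₁ * X₁ + s₂ * X₂))
    (hPAC : PAC = s₁ * (α₁ + y₁ * (β₁ * β₂)) + s₂ * (α₂ + y₂ * (β₁ * β₂)) + s₃ * pa)
    (hPBC : PBC = s₁ * (β₁ + z₁ * (α₁ * α₂)) + s₂ * (β₂ + z₂ * (α₁ * α₂)) + s₃ * pb)
    (hPABC : PABC = θC - wC + s₃ * Xc)
    (HC : PABC - PAC * PBC ≤ wC * Real.log (θC / wC)) :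
    PAB - PA * PB ≤ w * Real.log (θ / w) := by
  obtain ⟨h1α₁, h1α₂, h1β₁, h1β₂, h1γ₁, h1γ₂⟩ : 0 < 1 - α₁ ∧ 0 < 1 - α₂ ∧ 0 < 1 - β₁ ∧ 0 < 1 - β₂ ∧
      0 < 1 - γ₁ ∧ 0 < 1 - γ₂ := ⟨by linarith, by linarith, by linarith, by linarith, by linarith, by linarith⟩
  have h1ρ : 0 ≤ 1 - ρ := by linarith
  have hy₁nn : 0 ≤ y₁ := by rw [hy₁]; exact mul_nonneg h1α₁.le hα₂.le
  have hy₂nn : 0 ≤ y₂ := by rw [hy₂]; exact mul_nonneg hα₁.le h1α₂.le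
  have hz₁nn : 0 ≤ z₁ := by rw [hz₁]; exact mul_nonneg h1β₁.le hβ₂.le
  have hz₂nn : 0 ≤ z₂ := by rw [hz₂]; exact mul_nonneg hβ₁.le h1β₂.le
  have hX₁nn : 0 ≤ X₁ := by rw [hX₁]; exact mul_nonneg hy₁nn hz₁nn
  have hX₂nn : 0 ≤ X₂ := by rw [hX₂]; exact mul_nonneg hy₂nn hz₂nn
  have hXcnn : 0 ≤ Xc := by rw [hXc]; exact add_nonneg (mul_nonneg hy₁nn hz₂nn) (mul_nonneg hy₂nn hz₁nn)
  have hs₀pos : 0 < s₀ := by rw [hs₀]; exact mul_pos h1γ₁ h1γ₂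
  have hs₁nn : 0 ≤ s₁ := by rw [hs₁]; exact mul_nonneg hγ₁ h1γ₂.le
  have hs₂nn : 0 ≤ s₂ := by rw [hs₂]; exact mul_nonneg h1γ₁.le hγ₂
  have hA₂nn : 0 ≤ α₁ * α₂ := mul_nonneg hα₁.le hα₂.le
  have hB₂nn : 0 ≤ β₁ * β₂ := mul_nonneg hβ₁.le hβ₂.le
  have hA₂le : α₁ * α₂ ≤ 1 := by
    have := mul_le_mul hα₁1.le hα₂1.le hα₂.le zero_le_one; linarith
  have hB₂le : β₁ * β₂ ≤ 1 := by
    have := mul_le_mul hβ₁1.le hβ₂1.le hβ₂.le zero_le_one; linarith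
  have hKnn : 0 ≤ (1 - β₁ * β₂) * (1 - α₁ * α₂) := mul_nonneg (by linarith) (by linarith)
  have hKle : (1 - β₁ * β₂) * (1 - α₁ * α₂) ≤ 1 := by
    have := mul_le_mul (show 1 - β₁ * β₂ ≤ 1 by linarith) (show 1 - α₁ * α₂ ≤ 1 by linarith)
      (by linarith : 0 ≤ 1 - α₁ * α₂) zero_le_one
    linarith
  have hθCpos : 0 < θC := by
    have e : θC = α₁ * β₁ * (1 - α₂ * β₂) + α₂ * β₂ := by
      rw [hθC, hpa, hpb, hXc, hy₁, hy₂, hz₁, hz₂]; ring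
    have hab : α₂ * β₂ ≤ 1 := by
      have := mul_le_mul hα₂1.le hβ₂1.le hβ₂.le zero_le_one; linarith
    rw [e]
    exact add_pos_of_nonneg_of_pos (mul_nonneg (mul_nonneg hα₁.le hβ₁.le) (by linarith)) (mul_pos hα₂ hβ₂)
  have hmass : X₁ + X₂ + Xc ≤ pa * pb := by
    have e : pa * pb - (X₁ + X₂ + Xc) =
        (y₁ + y₂) * (β₁ * β₂) + (α₁ * α₂) * (z₁ + z₂) + (α₁ * α₂) * (β₁ * β₂) := by
      rw [hX₁, hX₂, hXc, hpa, hpb, hy₁, hy₂, hz₁, hz₂]; ring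
    have h : 0 ≤ (y₁ + y₂) * (β₁ * β₂) + (α₁ * α₂) * (z₁ + z₂) + (α₁ * α₂) * (β₁ * β₂) :=
      add_nonneg (add_nonneg (mul_nonneg (add_nonneg hy₁nn hy₂nn) hB₂nn)
        (mul_nonneg hA₂nn (add_nonneg hz₁nn hz₂nn))) (mul_nonneg hA₂nn hB₂nn)
    linarith
  have hsumnn : 0 ≤ X₁ + X₂ + Xc := add_nonneg (add_nonneg hX₁nn hX₂nn) hXcnn
  have hP : (1 - ρ) * X₁ + (1 - ρ) * X₂ + (1 - ρ) * Xc ≤ pa * pb := by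
    have h1 : (1 - ρ) * (X₁ + X₂ + Xc) ≤ 1 * (X₁ + X₂ + Xc) :=
      mul_le_mul_of_nonneg_right (by linarith) hsumnn
    linarith
  have hθge : θC ≤ θ := by
    have e : θ - θC = ρ * Xc := by rw [hθ, hθC]; ring
    have h : 0 ≤ ρ * Xc := mul_nonneg hρ hXcnn
    linarith
  have hθpos : 0 < θ := lt_of_lt_of_le hθCpos hθge
  have hXP : (1 - ρ) * Xc < pa * pb := by
    have : θ = pa * pb - (1 - ρ) * Xc := hθ
    linarith
  have hm₀nn : 0 ≤ s₁ * X₁ + s₂ * X₂ := add_nonneg (mul_nonneg hs₁nn hX₁nn) (mul_nonneg hs₂nn hX₂nn)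
  have hwCpos : 0 < wC := by
    rw [hwC]; exact add_pos_of_pos_of_nonneg (mul_pos hs₀pos hθCpos) hm₀nn
  have hwpos : 0 < w := by
    rw [hw]; exact add_pos_of_pos_of_nonneg (mul_pos hs₀pos hθpos) (mul_nonneg h1ρ hm₀nn)
  have hsg : wC * Real.log (θC / wC) ≤ wC * Real.log (θ / w) + (θC * w / θ - wC) :=
    GZParallel.mul_log_div_le hwCpos hθCpos hθpos hwpos
  have hθ' : θ = pa * pb - (1 - ρ) * Xc := hθ
  have hw' : w = s₀ * θ + (s₁ * ((1 - ρ) * X₁) + s₂ * ((1 - ρ) * X₂)) := by rw [hw]; ring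
  have hclub := club hγ₁ hγ₁1 hγ₂ hγ₂1 (mul_nonneg h1ρ hX₁nn) (mul_nonneg h1ρ hX₂nn) (mul_nonneg h1ρ hXcnn)
    hXP hs₀ hs₁ hs₂ hθ' hw'
  have hYZnn : 0 ≤ (s₁ * y₁ + s₂ * y₂) * (s₁ * z₁ + s₂ * z₂) :=
    mul_nonneg (add_nonneg (mul_nonneg hs₁nn hy₁nn) (mul_nonneg hs₂nn hy₂nn))
      (add_nonneg (mul_nonneg hs₁nn hz₁nn) (mul_nonneg hs₂nn hz₂nn))
  have hK : (1 - ρ) * ((1 - β₁ * β₂) * (s₁ * y₁ + s₂ * y₂)) * ((1 - α₁ * α₂) * (s₁ * z₁ + s₂ * z₂)) ≤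
      s₁ ^ 2 * ((1 - ρ) * X₁) + s₂ ^ 2 * ((1 - ρ) * X₂) + s₁ * s₂ * ((1 - ρ) * Xc) := by
    have e1 : s₁ ^ 2 * ((1 - ρ) * X₁) + s₂ ^ 2 * ((1 - ρ) * X₂) + s₁ * s₂ * ((1 - ρ) * Xc) =
        (1 - ρ) * (1 * ((s₁ * y₁ + s₂ * y₂) * (s₁ * z₁ + s₂ * z₂))) := by
      rw [hX₁, hX₂, hXc]; ring
    have e2 : (1 - ρ) * ((1 - β₁ * β₂) * (s₁ * y₁ + s₂ * y₂)) * ((1 - α₁ * α₂) * (s₁ * z₁ + s₂ * z₂)) =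
        (1 - ρ) * (((1 - β₁ * β₂) * (1 - α₁ * α₂)) * ((s₁ * y₁ + s₂ * y₂) * (s₁ * z₁ + s₂ * z₂))) := by ring
    rw [e1, e2]
    exact mul_le_mul_of_nonneg_left (mul_le_mul_of_nonneg_right hKle hYZnn) h1ρ
  set L := Real.log (θ / w) with hL
  have hA1 : (1 - ρ) * wC = w - ρ * (s₀ * (pa * pb)) := by rw [hwC, hw, hθ, hθC]; ring
  have hA2 : (1 - ρ) * θC = θ - ρ * (pa * pb) := by rw [hθ, hθC]; ring
  have hθw : θ * (w / θ) = w := by field_simp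
  have stepA : w * L - (1 - ρ) * (wC * L + (θC * w / θ - wC)) =
      ρ * (pa * pb) * (s₀ * (L - 1) + w / θ) := by
    have e : (1 - ρ) * (wC * L + (θC * w / θ - wC)) =
        ((1 - ρ) * wC) * L + ((1 - ρ) * θC) * (w / θ) - (1 - ρ) * wC := by ring
    rw [e, hA1, hA2]
    linear_combination (-1 : ℝ) * hθw
  have stepB : (PAB - PA * PB) - (1 - ρ) * (PABC - PAC * PBC) =
      ρ * (s₀ * (1 - s₀) * (pa * pb)) +
        ρ * ((1 - ρ) * ((1 - β₁ * β₂) * (s₁ * y₁ + s₂ * y₂)) * ((1 - α₁ * α₂) * (s₁ * z₁ + s₂ * z₂))) := by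
    rw [hPAB, hPA, hPB, hPABC, hPAC, hPBC, hw, hwC, hθ, hθC, hX₁, hX₂, hXc, hs₃, hs₀, hs₁, hs₂, hpa, hpb,
      hy₁, hy₂, hz₁, hz₂]
    ring
  have hbr : 0 ≤ pa * pb * (s₀ * L + w / θ - 2 * s₀ + s₀ ^ 2) -
      (1 - ρ) * ((1 - β₁ * β₂) * (s₁ * y₁ + s₂ * y₂)) * ((1 - α₁ * α₂) * (s₁ * z₁ + s₂ * z₂)) := by
    linarith
  have h4 : 0 ≤ ρ * (pa * pb * (s₀ * L + w / θ - 2 * s₀ + s₀ ^ 2) -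
      (1 - ρ) * ((1 - β₁ * β₂) * (s₁ * y₁ + s₂ * y₂)) * ((1 - α₁ * α₂) * (s₁ * z₁ + s₂ * z₂))) :=
    mul_nonneg hρ hbr
  have h5 : 0 ≤ (1 - ρ) * ((wC * L + (θC * w / θ - wC)) - (PABC - PAC * PBC)) :=
    mul_nonneg h1ρ (by linarith)
  have e5 : (1 - ρ) * ((wC * L + (θC * w / θ - wC)) - (PABC - PAC * PBC)) =
      (1 - ρ) * (wC * L + (θC * w / θ - wC)) - (1 - ρ) * (PABC - PAC * PBC) := by ring
  have e4 : ρ * (pa * pb * (s₀ * L + w / θ - 2 * s₀ + s₀ ^ 2) -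
      (1 - ρ) * ((1 - β₁ * β₂) * (s₁ * y₁ + s₂ * y₂)) * ((1 - α₁ * α₂) * (s₁ * z₁ + s₂ * z₂))) =
      ρ * (pa * pb) * (s₀ * (L - 1) + w / θ) - (ρ * (s₀ * (1 - s₀) * (pa * pb)) +
        ρ * ((1 - ρ) * ((1 - β₁ * β₂) * (s₁ * y₁ + s₂ * y₂)) * ((1 - α₁ * α₂) * (s₁ * z₁ + s₂ * z₂)))) := by
    ring
  linarith

/-- The 4-cycle with hubs at `u, v` (the case `ρ = 0`) satisfies the bound: it is the parallel composition of the hub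
paths `a–u–b` and `a–v–b`, so `GZParallel.parallel_cov_sub_mul_log_le` applies to the two path laws
`(t, w, q, y, x, n) = (αβγ, αβ(1−γ), 0, α(1−β)γ, (1−α)βγ, 1 − αβ − γ(α(1−β) + (1−α)β))` (their Harris constraints are the
identities `n·t − y(w+x) = αβγ(1−α)(1−γ)`, `n·t − x(w+y) = αβγ(1−β)(1−γ)`), each of which satisfies the bound by
`γ ≤ −log(1−γ)`. [this work] -/
theorem c4_cov_le {α₁ α₂ β₁ β₂ γ₁ γ₂ : ℝ}
    (hα₁ : 0 < α₁) (hα₁1 : α₁ < 1) (hα₂ : 0 < α₂) (hα₂1 : α₂ < 1)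
    (hβ₁ : 0 < β₁) (hβ₁1 : β₁ < 1) (hβ₂ : 0 < β₂) (hβ₂1 : β₂ < 1)
    (hγ₁ : 0 ≤ γ₁) (hγ₁1 : γ₁ < 1) (hγ₂ : 0 ≤ γ₂) (hγ₂1 : γ₂ < 1)
    {s₀ s₁ s₂ s₃ pa pb y₁ y₂ z₁ z₂ X₁ X₂ Xc θC wC PAC PBC PABC : ℝ}
    (hs₀ : s₀ = (1 - γ₁) * (1 - γ₂)) (hs₁ : s₁ = γ₁ * (1 - γ₂)) (hs₂ : s₂ = (1 - γ₁) * γ₂) (hs₃ : s₃ = γ₁ * γ₂)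
    (hpa : pa = 1 - (1 - α₁) * (1 - α₂)) (hpb : pb = 1 - (1 - β₁) * (1 - β₂))
    (hy₁ : y₁ = (1 - α₁) * α₂) (hy₂ : y₂ = α₁ * (1 - α₂)) (hz₁ : z₁ = (1 - β₁) * β₂) (hz₂ : z₂ = β₁ * (1 - β₂))
    (hX₁ : X₁ = y₁ * z₁) (hX₂ : X₂ = y₂ * z₂) (hXc : Xc = y₁ * z₂ + y₂ * z₁)
    (hθC : θC = pa * pb - Xc) (hwC : wC = s₀ * θC + (s₁ * X₁ + s₂ * X₂))
    (hPAC : PAC = s₁ * (α₁ + y₁ * (β₁ * β₂)) + s₂ * (α₂ + y₂ * (β₁ * β₂)) + s₃ * pa)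
    (hPBC : PBC = s₁ * (β₁ + z₁ * (α₁ * α₂)) + s₂ * (β₂ + z₂ * (α₁ * α₂)) + s₃ * pb)
    (hPABC : PABC = θC - wC + s₃ * Xc) :
    PABC - PAC * PBC ≤ wC * Real.log (θC / wC) := by
  obtain ⟨h1α₁, h1α₂, h1β₁, h1β₂, h1γ₁, h1γ₂⟩ : 0 < 1 - α₁ ∧ 0 < 1 - α₂ ∧ 0 < 1 - β₁ ∧ 0 < 1 - β₂ ∧
      0 < 1 - γ₁ ∧ 0 < 1 - γ₂ := ⟨by linarith, by linarith, by linarith, by linarith, by linarith, by linarith⟩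
  set t₁ := α₁ * β₁ * γ₁ with ht₁
  set w₁ := α₁ * β₁ * (1 - γ₁) with hw₁
  set x₁ := (1 - α₁) * β₁ * γ₁ with hx₁
  set v₁ := α₁ * (1 - β₁) * γ₁ with hv₁
  set n₁ := (1 - α₁) * (1 - β₁) + (1 - γ₁) * (α₁ * (1 - β₁) + (1 - α₁) * β₁) with hn₁
  set t₂ := α₂ * β₂ * γ₂ with ht₂
  set w₂ := α₂ * β₂ * (1 - γ₂) with hw₂
  set x₂ := (1 - α₂) * β₂ * γ₂ with hx₂
  set v₂ := α₂ * (1 - β₂) * γ₂ with hv₂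
  set n₂ := (1 - α₂) * (1 - β₂) + (1 - γ₂) * (α₂ * (1 - β₂) + (1 - α₂) * β₂) with hn₂
  have hw₁pos : 0 < w₁ := mul_pos (mul_pos hα₁ hβ₁) h1γ₁
  have hw₂pos : 0 < w₂ := mul_pos (mul_pos hα₂ hβ₂) h1γ₂
  have hmix₁ : 0 ≤ α₁ * (1 - β₁) + (1 - α₁) * β₁ :=
    add_nonneg (mul_nonneg hα₁.le h1β₁.le) (mul_nonneg h1α₁.le hβ₁.le)
  have hmix₂ : 0 ≤ α₂ * (1 - β₂) + (1 - α₂) * β₂ :=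
    add_nonneg (mul_nonneg hα₂.le h1β₂.le) (mul_nonneg h1α₂.le hβ₂.le)
  have hn₁pos : 0 < n₁ := add_pos_of_pos_of_nonneg (mul_pos h1α₁ h1β₁) (mul_nonneg h1γ₁.le hmix₁)
  have hn₂pos : 0 < n₂ := add_pos_of_pos_of_nonneg (mul_pos h1α₂ h1β₂) (mul_nonneg h1γ₂.le hmix₂)
  have ht₁nn : 0 ≤ t₁ := mul_nonneg (mul_nonneg hα₁.le hβ₁.le) hγ₁
  have ht₂nn : 0 ≤ t₂ := mul_nonneg (mul_nonneg hα₂.le hβ₂.le) hγ₂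
  have hx₁nn : 0 ≤ x₁ := mul_nonneg (mul_nonneg h1α₁.le hβ₁.le) hγ₁
  have hx₂nn : 0 ≤ x₂ := mul_nonneg (mul_nonneg h1α₂.le hβ₂.le) hγ₂
  have hv₁nn : 0 ≤ v₁ := mul_nonneg (mul_nonneg hα₁.le h1β₁.le) hγ₁
  have hv₂nn : 0 ≤ v₂ := mul_nonneg (mul_nonneg hα₂.le h1β₂.le) hγ₂
  have hsum₁ : t₁ + w₁ + 0 + x₁ + v₁ + n₁ = 1 := by rw [ht₁, hw₁, hx₁, hv₁, hn₁]; ring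
  have hsum₂ : t₂ + w₂ + 0 + x₂ + v₂ + n₂ = 1 := by rw [ht₂, hw₂, hx₂, hv₂, hn₂]; ring
  have hαβγ₁ : 0 ≤ α₁ * β₁ * γ₁ := ht₁nn
  have hαβγ₂ : 0 ≤ α₂ * β₂ * γ₂ := ht₂nn
  have H3₁ : v₁ * (w₁ + x₁) ≤ n₁ * (t₁ + 0) := by
    have e : n₁ * (t₁ + 0) - v₁ * (w₁ + x₁) = α₁ * β₁ * γ₁ * ((1 - α₁) * (1 - γ₁)) := by
      rw [hn₁, ht₁, hv₁, hw₁, hx₁]; ring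
    have h : 0 ≤ α₁ * β₁ * γ₁ * ((1 - α₁) * (1 - γ₁)) := mul_nonneg hαβγ₁ (mul_nonneg h1α₁.le h1γ₁.le)
    linarith
  have H4₁ : x₁ * (w₁ + v₁) ≤ n₁ * (t₁ + 0) := by
    have e : n₁ * (t₁ + 0) - x₁ * (w₁ + v₁) = α₁ * β₁ * γ₁ * ((1 - β₁) * (1 - γ₁)) := by
      rw [hn₁, ht₁, hv₁, hw₁, hx₁]; ring
    have h : 0 ≤ α₁ * β₁ * γ₁ * ((1 - β₁) * (1 - γ₁)) := mul_nonneg hαβγ₁ (mul_nonneg h1β₁.le h1γ₁.le)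
    linarith
  have H3₂ : v₂ * (w₂ + x₂) ≤ n₂ * (t₂ + 0) := by
    have e : n₂ * (t₂ + 0) - v₂ * (w₂ + x₂) = α₂ * β₂ * γ₂ * ((1 - α₂) * (1 - γ₂)) := by
      rw [hn₂, ht₂, hv₂, hw₂, hx₂]; ring
    have h : 0 ≤ α₂ * β₂ * γ₂ * ((1 - α₂) * (1 - γ₂)) := mul_nonneg hαβγ₂ (mul_nonneg h1α₂.le h1γ₂.le)
    linarith
  have H4₂ : x₂ * (w₂ + v₂) ≤ n₂ * (t₂ + 0) := by
    have e : n₂ * (t₂ + 0) - x₂ * (w₂ + v₂) = α₂ * β₂ * γ₂ * ((1 - β₂) * (1 - γ₂)) := by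
      rw [hn₂, ht₂, hv₂, hw₂, hx₂]; ring
    have h : 0 ≤ α₂ * β₂ * γ₂ * ((1 - β₂) * (1 - γ₂)) := mul_nonneg hαβγ₂ (mul_nonneg h1β₂.le h1γ₂.le)
    linarith
  have hpar := GZParallel.parallel_cov_sub_mul_log_le ht₁nn hw₁pos le_rfl hx₁nn hv₁nn hn₁pos
    ht₂nn hw₂pos le_rfl hx₂nn hv₂nn hn₂pos hsum₁ hsum₂ H3₁ H4₁ H3₂ H4₂
  have hpath₁ : (w₁ + n₁) * (t₁ + 0) - x₁ * v₁ - w₁ * Real.log ((t₁ + w₁) / w₁) ≤ 0 := by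
    have e1 : (w₁ + n₁) * (t₁ + 0) - x₁ * v₁ = α₁ * β₁ * (1 - γ₁) * γ₁ := by
      rw [hw₁, hn₁, ht₁, hx₁, hv₁]; ring
    have e2 : (t₁ + w₁) / w₁ = (1 - γ₁)⁻¹ := by
      rw [ht₁, hw₁]
      have hne : α₁ * β₁ ≠ 0 := (mul_pos hα₁ hβ₁).ne'
      field_simp
      ring
    rw [e1, e2, Real.log_inv]
    have hl : γ₁ ≤ -Real.log (1 - γ₁) := by have := Real.log_le_sub_one_of_pos h1γ₁; linarith
    have hc : 0 ≤ α₁ * β₁ * (1 - γ₁) := mul_nonneg (mul_nonneg hα₁.le hβ₁.le) h1γ₁.le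
    have h := mul_le_mul_of_nonneg_left hl hc
    have e3 : w₁ * -Real.log (1 - γ₁) = α₁ * β₁ * (1 - γ₁) * -Real.log (1 - γ₁) := by rw [hw₁]
    linarith
  have hpath₂ : (w₂ + n₂) * (t₂ + 0) - x₂ * v₂ - w₂ * Real.log ((t₂ + w₂) / w₂) ≤ 0 := by
    have e1 : (w₂ + n₂) * (t₂ + 0) - x₂ * v₂ = α₂ * β₂ * (1 - γ₂) * γ₂ := by
      rw [hw₂, hn₂, ht₂, hx₂, hv₂]; ring
    have e2 : (t₂ + w₂) / w₂ = (1 - γ₂)⁻¹ := by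
      rw [ht₂, hw₂]
      have hne : α₂ * β₂ ≠ 0 := (mul_pos hα₂ hβ₂).ne'
      field_simp
      ring
    rw [e1, e2, Real.log_inv]
    have hl : γ₂ ≤ -Real.log (1 - γ₂) := by have := Real.log_le_sub_one_of_pos h1γ₂; linarith
    have hc : 0 ≤ α₂ * β₂ * (1 - γ₂) := mul_nonneg (mul_nonneg hα₂.le hβ₂.le) h1γ₂.le
    have h := mul_le_mul_of_nonneg_left hl hc
    have e3 : w₂ * -Real.log (1 - γ₂) = α₂ * β₂ * (1 - γ₂) * -Real.log (1 - γ₂) := by rw [hw₂]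
    linarith
  have hz₁nn : 0 ≤ w₁ + n₁ := by linarith
  have hz₂nn : 0 ≤ w₂ + n₂ := by linarith
  have hr₁ := mul_nonpos_of_nonneg_of_nonpos hz₂nn hpath₁
  have hr₂ := mul_nonpos_of_nonneg_of_nonpos hz₁nn hpath₂
  have eC : (w₁ + n₁) * (w₂ + n₂) -
      ((n₁ + x₁) * (n₂ + x₂) + ((w₁ + n₁) * (w₂ + n₂) - n₁ * n₂)) *
        ((n₁ + v₁) * (n₂ + v₂) + ((w₁ + n₁) * (w₂ + n₂) - n₁ * n₂)) = PABC - PAC * PBC := by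
    rw [hPABC, hPAC, hPBC, hwC, hθC, hs₀, hs₁, hs₂, hs₃, hpa, hpb, hX₁, hX₂, hXc, hy₁, hy₂, hz₁, hz₂,
      hw₁, hn₁, hx₁, hv₁, hw₂, hn₂, hx₂, hv₂]
    ring
  have eW : (w₁ + n₁) * (w₂ + n₂) - n₁ * n₂ = wC := by
    rw [hwC, hθC, hs₀, hs₁, hs₂, hpa, hpb, hX₁, hX₂, hXc, hy₁, hy₂, hz₁, hz₂, hw₁, hn₁, hw₂, hn₂]; ring
  have eT : (t₁ + w₁) + (t₂ + w₂) - (t₁ + w₁) * (t₂ + w₂) = θC := by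
    rw [hθC, hpa, hpb, hXc, hy₁, hy₂, hz₁, hz₂, ht₁, hw₁, ht₂, hw₂]; ring
  rw [eC, eW, eT] at hpar
  linarith

/-- **THEOREM W (cell level)** — the logarithmic covariance bound
`P(a↔c ∧ b↔c) − P(a↔c)P(b↔c) ≤ P(ab|c)·log(P(a↔b off c)/P(ab|c))` for the cell polynomials of the Wheatstone bridge
`{au, av, ub, vb, uv}` with hub edges `cu, cv` (weights of the bridge core in `(0,1)`, bridge weight `ρ ∈ [0,1]`, hub weights in
`[0,1)`): `θ = P(a↔b off c)`, `w = P(ab|c)`, `PA = P(a↔c)`, `PB = P(b↔c)`, `PAB = P(a↔c ∧ b↔c)` as polynomials in the weights.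
The first instance of the Gladkov–Zimin Conj. 6.3 / Gladkov Conj. 10.1 bound (modulus `w log(1/w)`) whose `a–b` core is not
series–parallel and carries internal hubs.  [this work — memo THEOREM-W.md] -/
theorem wheatstone_cov_le {α₁ α₂ β₁ β₂ ρ γ₁ γ₂ : ℝ}
    (hα₁ : 0 < α₁) (hα₁1 : α₁ < 1) (hα₂ : 0 < α₂) (hα₂1 : α₂ < 1)
    (hβ₁ : 0 < β₁) (hβ₁1 : β₁ < 1) (hβ₂ : 0 < β₂) (hβ₂1 : β₂ < 1)
    (hρ : 0 ≤ ρ) (hρ1 : ρ ≤ 1) (hγ₁ : 0 ≤ γ₁) (hγ₁1 : γ₁ < 1) (hγ₂ : 0 ≤ γ₂) (hγ₂1 : γ₂ < 1)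
    {s₀ s₁ s₂ s₃ pa pb y₁ y₂ z₁ z₂ X₁ X₂ Xc θ w PA PB PAB : ℝ}
    (hs₀ : s₀ = (1 - γ₁) * (1 - γ₂)) (hs₁ : s₁ = γ₁ * (1 - γ₂)) (hs₂ : s₂ = (1 - γ₁) * γ₂) (hs₃ : s₃ = γ₁ * γ₂)
    (hpa : pa = 1 - (1 - α₁) * (1 - α₂)) (hpb : pb = 1 - (1 - β₁) * (1 - β₂))
    (hy₁ : y₁ = (1 - α₁) * α₂) (hy₂ : y₂ = α₁ * (1 - α₂)) (hz₁ : z₁ = (1 - β₁) * β₂) (hz₂ : z₂ = β₁ * (1 - β₂))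
    (hX₁ : X₁ = y₁ * z₁) (hX₂ : X₂ = y₂ * z₂) (hXc : Xc = y₁ * z₂ + y₂ * z₁)
    (hθ : θ = pa * pb - (1 - ρ) * Xc) (hw : w = s₀ * θ + (1 - ρ) * (s₁ * X₁ + s₂ * X₂))
    (hPA : PA = (1 - ρ) * (s₁ * (α₁ + y₁ * (β₁ * β₂)) + s₂ * (α₂ + y₂ * (β₁ * β₂)) + s₃ * pa) + ρ * ((1 - s₀) * pa))
    (hPB : PB = (1 - ρ) * (s₁ * (β₁ + z₁ * (α₁ * α₂)) + s₂ * (β₂ + z₂ * (α₁ * α₂)) + s₃ * pb) + ρ * ((1 - s₀) * pb))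
    (hPAB : PAB = θ - w + s₃ * ((1 - ρ) * Xc)) :
    PAB - PA * PB ≤ w * Real.log (θ / w) :=
  wheatstone_cov_le_of_C4 hα₁ hα₁1 hα₂ hα₂1 hβ₁ hβ₁1 hβ₂ hβ₂1 hρ hρ1 hγ₁ hγ₁1 hγ₂ hγ₂1
    hs₀ hs₁ hs₂ hs₃ hpa hpb hy₁ hy₂ hz₁ hz₂ hX₁ hX₂ hXc hθ hw hPA hPB hPAB rfl rfl rfl rfl rfl
    (c4_cov_le hα₁ hα₁1 hα₂ hα₂1 hβ₁ hβ₁1 hβ₂ hβ₂1 hγ₁ hγ₁1 hγ₂ hγ₂1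
      hs₀ hs₁ hs₂ hs₃ hpa hpb hy₁ hy₂ hz₁ hz₂ hX₁ hX₂ hXc rfl rfl rfl rfl rfl)

end GZWheatstone

end Summit.CriticalPhenomena.PercolationContinuityZ3.Theorems
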